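import Summits.BirchSwinnertonDyer.BirchSwinnertonDyer.Theorems.SylvesterTwoHeegnerIndexCoupledDescentFirstLayerOfLayerL1
import Literature.NumberTheory.EllipticCurves.HuShuYin2019.SylvesterPairGoodPlaces
import Literature.NumberTheory.EllipticCurves.HeegnerPointsKolyvaginClassesPointsProofs
import Literature.NumberTheory.EllipticCurves.JZeroKolyvaginPrimes
import HarnessLib

/-!
# Leaf (L1) for a bottom class `δY₁` from RECIPE-SHAPED coupled classes carrying ONLY the two
# AT-LEVEL FLIP iffs — the off-level local conditions and the infinite places are discharged here

Crux `UpperOffV0HSYPlus` (stmt-BirchSwinnertonDyer-19804), skeleton of record VARIANT M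
(`Cruxes/UpperOffV0HSYPlus/Lines/coupled_variantM.lean` 406ca288e244d392; D443): by
`layerL1Four_of_point` / `layerL1Seven_of_point` (p653566) the leaf stubs `stub_layerL1Four/Seven`
reduce to ONE point `Y₁ ∈ E_p(K)` with the named exponent-`0` display and **leaf (L1) for `δY₁`** —
p620148's binder at the conductor levels: coupled classes `c_A(ℓ) ∈ H¹(K, E_{3p²}[2])`,
`c_B(ℓℓ′) ∈ H¹(K, E_p[2])` that are (a) Selmer at every finite `v ∤ ℓ` (resp. `v ∤ ℓℓ′`), (b) Selmer
at the infinite places, (c) subject to the two FLIP iffs at `λ ∋ ℓ`.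

`L1_of_cmFrameClasses_four` / `L1_of_cmFrameClasses_seven`: (L1)[δY₁] — VERBATIM — follows from
classes `cA`, `cB` that are, at every Kolyvagin prime `ℓ` (resp. pair `ℓ ≠ ℓ′`) of the (L3) files'
eight-clause predicate, (i) **of RECIPE SHAPE** — `c = kolyvaginClass X_K 2 hdiv hA (ψ Q) hQ′` for SOME
embedded ring class field `K[9pn]` (`n = ℓ`, resp. `ℓℓ′`) with fixing group `N ≤ Γ_K`, a cubic-twist
transport `ψ : E_9(K̄) ≃ X(K̄)` scaling by `(v², v³)` with `N v = v`, an admissible `A ≤ X(K̄)` and a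
point `Q ∈ E_9(K̄)^N` with `ψ Q` invariant modulo `A` (exactly the binders of k-ty1's one-call
good-place theorems `kolyvaginClass_cmFrame_cubeSumCurve_{three_mul_sq,prime}_mem_selmerLocalKer`,
p645361; the recipe `HuShuYin2019.exists_cmFrame_kolyvaginClass` R0–R8 produces such data) — and
(ii) satisfy **the FLIP iff at `λ ∋ ℓ`** («`c_A(ℓ)` Selmer at `λ` ↔ `δY₁ ∈ T_B(λ)`», «`c_B(ℓℓ′)` Selmer
at `λ` ↔ `c_A(ℓ′) ∈ T_A(λ)`») — NOTHING ELSE on `p ≡ 4 (9)`; on `p ≡ 7 (9)` additionally (iii) the ONE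
displayed additive-place condition «`c_B(ℓℓ′)` Selmer at `w ∣ 3`» (there `B(K_w)[2] = B[2]`,
`H¹(K_w, B[2]) ≠ 0`: memo two §67.2 (W2-d), the (★)-fixing datum of k-ty1's
`kolyvaginClass_cubicTwist_chiComponent_mem_selmerLocalKer_of_isCoprime`, p648302).
Proof = k-ty1 g5's recipes (L1-fin)/(L1-inf) executed once: `v ∣ p` or `v ∣ 3` — additive, no
`K_v`-rational `2`-torsion, both local kernels `⊤` (`mem_localKers_cubeSumCurve_*`, p642937;
`B` at `v ∣ 3` needs `p % 9 = 4`); `v ∤ 3pℓ(ℓ′)` — good reduction (incl. `v ∣ 2`) and `K[9pn]/K`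
unramified at `v`, Gross 6.2 (1) (p645361 via p644516); `∞` — `K` imaginary quadratic
(`mem_selmerLocalKer_infinitePlace_of_isImaginaryQuadratic`).  NET for rows k-p1: leaf (L1) for the
CM bottom point = {recipe data per Kolyvagin prime (the class TERMS), the two FLIP iffs at `λ`
(shell p650073, dictionary p652939)} (+ `B` at `w ∣ 3` on `7 (9)`).  Theorem-only;
no stub closed; nothing asserted on 19804; no label moves; BSD not claimed for any curve.
-/

set_option linter.dupNamespace false -- Summits modules are `Summit.<Summit>.<Problem>…` by design

noncomputable section

open scoped Classical
open WeierstrassCurve WeierstrassCurve.Affine WeierstrassCurve.Affine.Point NumberField IsDedekindDomain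
open Field Literature.NumberTheory.EllipticCurves Literature.NumberTheory.GaloisRepresentations
open Literature.NumberTheory.EllipticCurves.HuShuYin2019
open Summit.BirchSwinnertonDyer.BirchSwinnertonDyer.Theses.SylvesterTwoHeegnerIndex
  hiding HSYPointTwoDivisibleSevenModNine

namespace Summit.BirchSwinnertonDyer.BirchSwinnertonDyer.Theorems.SylvesterTwoCoupledDescentCebotarev

section OffLevel

variable {K : Type} [Field K] [NumberField K]

omit [NumberField K] in
/-- `(a·b : 𝓞 K) ∉ v` from `(a : 𝓞 K) ∉ v`, `(b : 𝓞 K) ∉ v` (`v` prime). [folklore] -/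
private theorem natCast_mul_not_mem (v : HeightOneSpectrum (𝓞 K)) {a b : ℕ}
    (ha : ((a : ℕ) : 𝓞 K) ∉ v.asIdeal) (hb : ((b : ℕ) : 𝓞 K) ∉ v.asIdeal) :
    ((a * b : ℕ) : 𝓞 K) ∉ v.asIdeal := by
  intro h
  push_cast at h
  rcases v.isPrime.mem_or_mem h with h' | h'
  · exact ha h'
  · exact hb h'

omit [NumberField K] in
/-- `((9·p·n : ℕ) : 𝓞 K) ∉ v` when `3, p, n ∉ v`. [folklore] -/
private theorem natCast_nine_mul_not_mem (v : HeightOneSpectrum (𝓞 K)) {p n : ℕ}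
    (h3 : ((3 : ℕ) : 𝓞 K) ∉ v.asIdeal) (hp : ((p : ℕ) : 𝓞 K) ∉ v.asIdeal)
    (hn : ((n : ℕ) : 𝓞 K) ∉ v.asIdeal) : ((9 * p * n : ℕ) : 𝓞 K) ∉ v.asIdeal := by
  have h9 : ((9 : ℕ) : 𝓞 K) ∉ v.asIdeal := by
    have := natCast_mul_not_mem v h3 h3
    simpa using this
  exact natCast_mul_not_mem v (natCast_mul_not_mem v h9 hp) hn

/-- **Leaf (L1) for `δY₁` from recipe-shaped coupled classes with the FLIP iffs only** (`p ≡ 4 (9)`,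
`K ∋ ω` quadratic, `Y₁ ∈ E_p(K)` any point): the classes' off-level Selmer conditions at every finite
`v` and at `∞` are discharged from their recipe shape; the conclusion is p620148's (L1) binder
at the conductor levels VERBATIM (the second conjunct of `layerL1Four_of_point`'s hypothesis, p653566). -/
theorem L1_of_cmFrameClasses_four {ω : K} (hω : ω ^ 2 + ω + 1 = 0) (h2 : Module.finrank ℚ K = 2)
    {p : ℕ} (hp : p.Prime) (h9 : p % 9 = 4)
    (Y₁ : ((cubeSumCurve (p : ℚ)).baseChange K).toAffine.Point)
    (h : ∃ (cA : ℕ → galH1Torsion ((cubeSumCurve (3 * (p : ℚ) ^ 2)).baseChange K) (2 : ℕ))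
        (cB : ℕ → galH1Torsion ((cubeSumCurve (p : ℚ)).baseChange K) (2 : ℕ)),
      (∀ ℓ, (ℓ.Prime ∧ ¬ ℓ ∣ (cubeSumCurve (3 * (p : ℚ) ^ 2)).conductorNorm ℤ ∧
          ¬ ℓ ∣ (cubeSumCurve (p : ℚ)).conductorNorm ℤ ∧ ¬ ((ℓ : ℤ) ∣ NumberField.discr K) ∧ ℓ ≠ 2 ∧
          (Ideal.span {(ℓ : 𝓞 K)}).IsPrime ∧
          FrobEqFrobInfty (cubeSumCurve (3 * (p : ℚ) ^ 2)) K 2 ℓ ∧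
          FrobEqFrobInfty (cubeSumCurve (p : ℚ)) K 2 ℓ) →
        (∃ (ιK : K →+* ℂ) (emb : ringClassField K ιK (9 * p * ℓ) →+* AlgebraicClosure K)
            (_ : ∀ k : K, emb (algebraMap K (ringClassField K ιK (9 * p * ℓ)) k) =
              algebraMap K (AlgebraicClosure K) k)
            (N : Subgroup (Field.absoluteGaloisGroup K))
            (_ : ∀ g, g ∈ N ↔ ∀ x : ringClassField K ιK (9 * p * ℓ),
              (show AlgebraicClosure K ≃ₐ[K] AlgebraicClosure K from g) (emb x) = emb x)
            (v : AlgebraicClosure K)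
            (ψ : geomPoints ((cubeSumCurve 9).baseChange K) ≃+ geomPoints ((cubeSumCurve (3 * (p : ℚ) ^ 2)).baseChange K))
            (_ : ∀ {x y : AlgebraicClosure K}
              (h : (((cubeSumCurve 9).baseChange K).baseChange (AlgebraicClosure K)).toAffine.Nonsingular
                x y), ∃ h', ψ (Affine.Point.some x y h) = Affine.Point.some (v ^ 2 * x) (v ^ 3 * y) h')
            (_ : ∀ h ∈ N, (show AlgebraicClosure K ≃ₐ[K] AlgebraicClosure K from h) v = v)
            (A : AddSubgroup (geomPoints ((cubeSumCurve (3 * (p : ℚ) ^ 2)).baseChange K)))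
            (hdiv : ∀ P : geomPoints ((cubeSumCurve (3 * (p : ℚ) ^ 2)).baseChange K), ∃ R : geomPoints ((cubeSumCurve (3 * (p : ℚ) ^ 2)).baseChange K), ((2 : ℕ) : ℤ) • R = P)
            (hA : KolyvaginCocycle.IsAdmissible (Field.absoluteGaloisGroup K) A ((2 : ℕ) : ℤ))
            (Q : geomPoints ((cubeSumCurve 9).baseChange K))
            (_ : Q ∈ FixedPoints.addSubgroup N (geomPoints ((cubeSumCurve 9).baseChange K)))
            (hQ' : ψ Q ∈ KolyvaginCocycle.invPoints (Field.absoluteGaloisGroup K) A ((2 : ℕ) : ℤ)),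
            cA ℓ = kolyvaginClass ((cubeSumCurve (3 * (p : ℚ) ^ 2)).baseChange K) ((2 : ℕ) : ℤ) hdiv hA (ψ Q) hQ') ∧
        (∀ v : HeightOneSpectrum (𝓞 K), (ℓ : 𝓞 K) ∈ v.asIdeal →
          (cA ℓ ∈ selmerLocalKer ((cubeSumCurve (3 * (p : ℚ) ^ 2)).baseChange K)
              (v.adicCompletion K) (2 : ℕ) ↔
            kummerClassOfPoint (cubeSumCurve (p : ℚ)) K Nat.prime_two Y₁ ∈
              ((cubeSumCurve (p : ℚ)).baseChange K).torsionLocalKer (v.adicCompletion K) (2 : ℕ)))) ∧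
      (∀ ℓ ℓ', (ℓ.Prime ∧ ¬ ℓ ∣ (cubeSumCurve (3 * (p : ℚ) ^ 2)).conductorNorm ℤ ∧
          ¬ ℓ ∣ (cubeSumCurve (p : ℚ)).conductorNorm ℤ ∧ ¬ ((ℓ : ℤ) ∣ NumberField.discr K) ∧ ℓ ≠ 2 ∧
          (Ideal.span {(ℓ : 𝓞 K)}).IsPrime ∧
          FrobEqFrobInfty (cubeSumCurve (3 * (p : ℚ) ^ 2)) K 2 ℓ ∧
          FrobEqFrobInfty (cubeSumCurve (p : ℚ)) K 2 ℓ) →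
        (ℓ'.Prime ∧ ¬ ℓ' ∣ (cubeSumCurve (3 * (p : ℚ) ^ 2)).conductorNorm ℤ ∧
          ¬ ℓ' ∣ (cubeSumCurve (p : ℚ)).conductorNorm ℤ ∧ ¬ ((ℓ' : ℤ) ∣ NumberField.discr K) ∧
          ℓ' ≠ 2 ∧ (Ideal.span {(ℓ' : 𝓞 K)}).IsPrime ∧
          FrobEqFrobInfty (cubeSumCurve (3 * (p : ℚ) ^ 2)) K 2 ℓ' ∧
          FrobEqFrobInfty (cubeSumCurve (p : ℚ)) K 2 ℓ') → ℓ ≠ ℓ' →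
        (∃ (ιK : K →+* ℂ) (emb : ringClassField K ιK (9 * p * (ℓ * ℓ')) →+* AlgebraicClosure K)
            (_ : ∀ k : K, emb (algebraMap K (ringClassField K ιK (9 * p * (ℓ * ℓ'))) k) =
              algebraMap K (AlgebraicClosure K) k)
            (N : Subgroup (Field.absoluteGaloisGroup K))
            (_ : ∀ g, g ∈ N ↔ ∀ x : ringClassField K ιK (9 * p * (ℓ * ℓ')),
              (show AlgebraicClosure K ≃ₐ[K] AlgebraicClosure K from g) (emb x) = emb x)
            (v : AlgebraicClosure K)
            (ψ : geomPoints ((cubeSumCurve 9).baseChange K) ≃+ geomPoints ((cubeSumCurve (p : ℚ)).baseChange K))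
            (_ : ∀ {x y : AlgebraicClosure K}
              (h : (((cubeSumCurve 9).baseChange K).baseChange (AlgebraicClosure K)).toAffine.Nonsingular
                x y), ∃ h', ψ (Affine.Point.some x y h) = Affine.Point.some (v ^ 2 * x) (v ^ 3 * y) h')
            (_ : ∀ h ∈ N, (show AlgebraicClosure K ≃ₐ[K] AlgebraicClosure K from h) v = v)
            (A : AddSubgroup (geomPoints ((cubeSumCurve (p : ℚ)).baseChange K)))
            (hdiv : ∀ P : geomPoints ((cubeSumCurve (p : ℚ)).baseChange K), ∃ R : geomPoints ((cubeSumCurve (p : ℚ)).baseChange K), ((2 : ℕ) : ℤ) • R = P)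
            (hA : KolyvaginCocycle.IsAdmissible (Field.absoluteGaloisGroup K) A ((2 : ℕ) : ℤ))
            (Q : geomPoints ((cubeSumCurve 9).baseChange K))
            (_ : Q ∈ FixedPoints.addSubgroup N (geomPoints ((cubeSumCurve 9).baseChange K)))
            (hQ' : ψ Q ∈ KolyvaginCocycle.invPoints (Field.absoluteGaloisGroup K) A ((2 : ℕ) : ℤ)),
            cB (ℓ * ℓ') = kolyvaginClass ((cubeSumCurve (p : ℚ)).baseChange K) ((2 : ℕ) : ℤ) hdiv hA (ψ Q) hQ') ∧
        (∀ v : HeightOneSpectrum (𝓞 K), (ℓ : 𝓞 K) ∈ v.asIdeal →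
          (cB (ℓ * ℓ') ∈ selmerLocalKer ((cubeSumCurve (p : ℚ)).baseChange K)
              (v.adicCompletion K) (2 : ℕ) ↔
            cA ℓ' ∈ ((cubeSumCurve (3 * (p : ℚ) ^ 2)).baseChange K).torsionLocalKer
              (v.adicCompletion K) (2 : ℕ))))) :
    ∃ (cA : ℕ → galH1Torsion ((cubeSumCurve (3 * (p : ℚ) ^ 2)).baseChange K) (2 : ℕ))
      (cB : ℕ → galH1Torsion ((cubeSumCurve (p : ℚ)).baseChange K) (2 : ℕ)),
    (∀ ℓ, (ℓ.Prime ∧ ¬ ℓ ∣ (cubeSumCurve (3 * (p : ℚ) ^ 2)).conductorNorm ℤ ∧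
        ¬ ℓ ∣ (cubeSumCurve (p : ℚ)).conductorNorm ℤ ∧ ¬ ((ℓ : ℤ) ∣ NumberField.discr K) ∧ ℓ ≠ 2 ∧
        (Ideal.span {(ℓ : 𝓞 K)}).IsPrime ∧
        FrobEqFrobInfty (cubeSumCurve (3 * (p : ℚ) ^ 2)) K 2 ℓ ∧
        FrobEqFrobInfty (cubeSumCurve (p : ℚ)) K 2 ℓ) →
      (∀ v : HeightOneSpectrum (𝓞 K), (ℓ : 𝓞 K) ∉ v.asIdeal →
        cA ℓ ∈ selmerLocalKer ((cubeSumCurve (3 * (p : ℚ) ^ 2)).baseChange K)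
          (v.adicCompletion K) (2 : ℕ)) ∧
      (∀ x : InfinitePlace K, cA ℓ ∈ selmerLocalKer
        ((cubeSumCurve (3 * (p : ℚ) ^ 2)).baseChange K) x.Completion (2 : ℕ)) ∧
      (∀ v : HeightOneSpectrum (𝓞 K), (ℓ : 𝓞 K) ∈ v.asIdeal →
        (cA ℓ ∈ selmerLocalKer ((cubeSumCurve (3 * (p : ℚ) ^ 2)).baseChange K)
            (v.adicCompletion K) (2 : ℕ) ↔
          kummerClassOfPoint (cubeSumCurve (p : ℚ)) K Nat.prime_two Y₁ ∈
            ((cubeSumCurve (p : ℚ)).baseChange K).torsionLocalKer (v.adicCompletion K) (2 : ℕ)))) ∧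
    (∀ ℓ ℓ', (ℓ.Prime ∧ ¬ ℓ ∣ (cubeSumCurve (3 * (p : ℚ) ^ 2)).conductorNorm ℤ ∧
        ¬ ℓ ∣ (cubeSumCurve (p : ℚ)).conductorNorm ℤ ∧ ¬ ((ℓ : ℤ) ∣ NumberField.discr K) ∧ ℓ ≠ 2 ∧
        (Ideal.span {(ℓ : 𝓞 K)}).IsPrime ∧
        FrobEqFrobInfty (cubeSumCurve (3 * (p : ℚ) ^ 2)) K 2 ℓ ∧
        FrobEqFrobInfty (cubeSumCurve (p : ℚ)) K 2 ℓ) →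
      (ℓ'.Prime ∧ ¬ ℓ' ∣ (cubeSumCurve (3 * (p : ℚ) ^ 2)).conductorNorm ℤ ∧
        ¬ ℓ' ∣ (cubeSumCurve (p : ℚ)).conductorNorm ℤ ∧ ¬ ((ℓ' : ℤ) ∣ NumberField.discr K) ∧
        ℓ' ≠ 2 ∧ (Ideal.span {(ℓ' : 𝓞 K)}).IsPrime ∧
        FrobEqFrobInfty (cubeSumCurve (3 * (p : ℚ) ^ 2)) K 2 ℓ' ∧
        FrobEqFrobInfty (cubeSumCurve (p : ℚ)) K 2 ℓ') → ℓ ≠ ℓ' →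
      (∀ v : HeightOneSpectrum (𝓞 K), (ℓ : 𝓞 K) ∉ v.asIdeal → (ℓ' : 𝓞 K) ∉ v.asIdeal →
        cB (ℓ * ℓ') ∈ selmerLocalKer ((cubeSumCurve (p : ℚ)).baseChange K)
          (v.adicCompletion K) (2 : ℕ)) ∧
      (∀ x : InfinitePlace K,
        cB (ℓ * ℓ') ∈ selmerLocalKer ((cubeSumCurve (p : ℚ)).baseChange K) x.Completion (2 : ℕ)) ∧
      (∀ v : HeightOneSpectrum (𝓞 K), (ℓ : 𝓞 K) ∈ v.asIdeal →
        (cB (ℓ * ℓ') ∈ selmerLocalKer ((cubeSumCurve (p : ℚ)).baseChange K)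
            (v.adicCompletion K) (2 : ℕ) ↔
          cA ℓ' ∈ ((cubeSumCurve (3 * (p : ℚ) ^ 2)).baseChange K).torsionLocalKer
            (v.adicCompletion K) (2 : ℕ)))) := by
  obtain ⟨cA, cB, hAℓ, hBℓ⟩ := h
  have hK : IsImaginaryQuadratic K := JZero.isImaginaryQuadratic_of_sq_add_self_add_one hω h2
  have hp2 : p ≠ 2 := by rintro rfl; norm_num at h9
  have hp3 : p ≠ 3 := by rintro rfl; norm_num at h9
  have hp0 : p ≠ 0 := hp.ne_zero
  refine ⟨cA, cB, fun ℓ hℓ ↦ ⟨?_, ?_, (hAℓ ℓ hℓ).2⟩, fun ℓ ℓ' hℓ hℓ' hne ↦ ⟨?_, ?_, (hBℓ ℓ ℓ' hℓ hℓ' hne).2⟩⟩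
  · -- `c_A(ℓ)` off `ℓ`: finite places
    intro v hℓv
    by_cases hpv : ((p : ℕ) : 𝓞 K) ∈ v.asIdeal
    · exact (mem_localKers_cubeSumCurve_three_mul_sq_of_mem hω h2 hp hp2 hp3 v hpv 1 (cA ℓ)).1
    by_cases h3v : ((3 : ℕ) : 𝓞 K) ∈ v.asIdeal
    · exact (mem_localKers_cubeSumCurve_three_mul_sq_of_three_mem hω h2 hp hp3 v h3v 1 (cA ℓ)).1
    obtain ⟨⟨ιK, emb, hemb, N, hN, v9, ψ, hψ, hNv, A, hdiv, hA, Q, hQN, hQ', hc⟩, -⟩ := hAℓ ℓ hℓ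
    rw [hc]
    have hℓ0 : ℓ ≠ 0 := hℓ.1.ne_zero
    exact kolyvaginClass_cmFrame_cubeSumCurve_three_mul_sq_mem_selmerLocalKer hK ιK
      (by positivity) emb hemb N hN hp hp2 hψ hNv hA hQN hQ' v h3v hpv
      (natCast_nine_mul_not_mem v h3v hpv hℓv)
  · -- `c_A(ℓ)` at `∞`
    intro x
    exact mem_selmerLocalKer_infinitePlace_of_isImaginaryQuadratic hK _ x (cA ℓ)
  · -- `c_B(ℓℓ′)` off `ℓ, ℓ′`: finite places
    intro v hℓv hℓ'v
    by_cases hpv : ((p : ℕ) : 𝓞 K) ∈ v.asIdeal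
    · exact (mem_localKers_cubeSumCurve_prime_of_mem hω h2 hp hp2 hp3 v hpv 1 (cB (ℓ * ℓ'))).1
    obtain ⟨⟨ιK, emb, hemb, N, hN, v9, ψ, hψ, hNv, A, hdiv, hA, Q, hQN, hQ', hc⟩, -⟩ :=
      hBℓ ℓ ℓ' hℓ hℓ' hne
    by_cases h3v : ((3 : ℕ) : 𝓞 K) ∈ v.asIdeal
    · exact (mem_localKers_cubeSumCurve_prime_of_three_mem hω h2 hp h9 v h3v 1 (cB (ℓ * ℓ'))).1
    rw [hc]
    have hℓ0 : ℓ ≠ 0 := hℓ.1.ne_zero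
    have hℓ'0 : ℓ' ≠ 0 := hℓ'.1.ne_zero
    exact kolyvaginClass_cmFrame_cubeSumCurve_prime_mem_selmerLocalKer hK ιK (by positivity) emb hemb
      N hN hp hp2 hψ hNv hA hQN hQ' v h3v hpv
      (natCast_nine_mul_not_mem v h3v hpv (natCast_mul_not_mem v hℓv hℓ'v))
  · -- `c_B(ℓℓ′)` at `∞`
    intro x
    exact mem_selmerLocalKer_infinitePlace_of_isImaginaryQuadratic hK _ x (cB (ℓ * ℓ'))

/-- **Leaf (L1) for `δY₁` from recipe-shaped coupled classes with the FLIP iffs only** (`p ≡ 7 (9)`,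
`K ∋ ω` quadratic, `Y₁ ∈ E_p(K)` any point): the classes' off-level Selmer conditions at every finite
`v` and at `∞` are discharged from their recipe shape and, for `c_B`, the displayed Selmer condition at `w ∣ 3` (additive place of `E_p` with `B(K_w)[2] = B[2]` on this residue class; the (★)-fixing datum, not supplied here); the conclusion is p620148's (L1) binder
at the conductor levels VERBATIM (the second conjunct of `layerL1Seven_of_point`'s hypothesis, p653566). -/
theorem L1_of_cmFrameClasses_seven {ω : K} (hω : ω ^ 2 + ω + 1 = 0) (h2 : Module.finrank ℚ K = 2)
    {p : ℕ} (hp : p.Prime) (h9 : p % 9 = 7)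
    (Y₁ : ((cubeSumCurve (p : ℚ)).baseChange K).toAffine.Point)
    (h : ∃ (cA : ℕ → galH1Torsion ((cubeSumCurve (3 * (p : ℚ) ^ 2)).baseChange K) (2 : ℕ))
        (cB : ℕ → galH1Torsion ((cubeSumCurve (p : ℚ)).baseChange K) (2 : ℕ)),
      (∀ ℓ, (ℓ.Prime ∧ ¬ ℓ ∣ (cubeSumCurve (3 * (p : ℚ) ^ 2)).conductorNorm ℤ ∧
          ¬ ℓ ∣ (cubeSumCurve (p : ℚ)).conductorNorm ℤ ∧ ¬ ((ℓ : ℤ) ∣ NumberField.discr K) ∧ ℓ ≠ 2 ∧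
          (Ideal.span {(ℓ : 𝓞 K)}).IsPrime ∧
          FrobEqFrobInfty (cubeSumCurve (3 * (p : ℚ) ^ 2)) K 2 ℓ ∧
          FrobEqFrobInfty (cubeSumCurve (p : ℚ)) K 2 ℓ) →
        (∃ (ιK : K →+* ℂ) (emb : ringClassField K ιK (9 * p * ℓ) →+* AlgebraicClosure K)
            (_ : ∀ k : K, emb (algebraMap K (ringClassField K ιK (9 * p * ℓ)) k) =
              algebraMap K (AlgebraicClosure K) k)
            (N : Subgroup (Field.absoluteGaloisGroup K))
            (_ : ∀ g, g ∈ N ↔ ∀ x : ringClassField K ιK (9 * p * ℓ),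
              (show AlgebraicClosure K ≃ₐ[K] AlgebraicClosure K from g) (emb x) = emb x)
            (v : AlgebraicClosure K)
            (ψ : geomPoints ((cubeSumCurve 9).baseChange K) ≃+ geomPoints ((cubeSumCurve (3 * (p : ℚ) ^ 2)).baseChange K))
            (_ : ∀ {x y : AlgebraicClosure K}
              (h : (((cubeSumCurve 9).baseChange K).baseChange (AlgebraicClosure K)).toAffine.Nonsingular
                x y), ∃ h', ψ (Affine.Point.some x y h) = Affine.Point.some (v ^ 2 * x) (v ^ 3 * y) h')
            (_ : ∀ h ∈ N, (show AlgebraicClosure K ≃ₐ[K] AlgebraicClosure K from h) v = v)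
            (A : AddSubgroup (geomPoints ((cubeSumCurve (3 * (p : ℚ) ^ 2)).baseChange K)))
            (hdiv : ∀ P : geomPoints ((cubeSumCurve (3 * (p : ℚ) ^ 2)).baseChange K), ∃ R : geomPoints ((cubeSumCurve (3 * (p : ℚ) ^ 2)).baseChange K), ((2 : ℕ) : ℤ) • R = P)
            (hA : KolyvaginCocycle.IsAdmissible (Field.absoluteGaloisGroup K) A ((2 : ℕ) : ℤ))
            (Q : geomPoints ((cubeSumCurve 9).baseChange K))
            (_ : Q ∈ FixedPoints.addSubgroup N (geomPoints ((cubeSumCurve 9).baseChange K)))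
            (hQ' : ψ Q ∈ KolyvaginCocycle.invPoints (Field.absoluteGaloisGroup K) A ((2 : ℕ) : ℤ)),
            cA ℓ = kolyvaginClass ((cubeSumCurve (3 * (p : ℚ) ^ 2)).baseChange K) ((2 : ℕ) : ℤ) hdiv hA (ψ Q) hQ') ∧
        (∀ v : HeightOneSpectrum (𝓞 K), (ℓ : 𝓞 K) ∈ v.asIdeal →
          (cA ℓ ∈ selmerLocalKer ((cubeSumCurve (3 * (p : ℚ) ^ 2)).baseChange K)
              (v.adicCompletion K) (2 : ℕ) ↔
            kummerClassOfPoint (cubeSumCurve (p : ℚ)) K Nat.prime_two Y₁ ∈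
              ((cubeSumCurve (p : ℚ)).baseChange K).torsionLocalKer (v.adicCompletion K) (2 : ℕ)))) ∧
      (∀ ℓ ℓ', (ℓ.Prime ∧ ¬ ℓ ∣ (cubeSumCurve (3 * (p : ℚ) ^ 2)).conductorNorm ℤ ∧
          ¬ ℓ ∣ (cubeSumCurve (p : ℚ)).conductorNorm ℤ ∧ ¬ ((ℓ : ℤ) ∣ NumberField.discr K) ∧ ℓ ≠ 2 ∧
          (Ideal.span {(ℓ : 𝓞 K)}).IsPrime ∧
          FrobEqFrobInfty (cubeSumCurve (3 * (p : ℚ) ^ 2)) K 2 ℓ ∧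
          FrobEqFrobInfty (cubeSumCurve (p : ℚ)) K 2 ℓ) →
        (ℓ'.Prime ∧ ¬ ℓ' ∣ (cubeSumCurve (3 * (p : ℚ) ^ 2)).conductorNorm ℤ ∧
          ¬ ℓ' ∣ (cubeSumCurve (p : ℚ)).conductorNorm ℤ ∧ ¬ ((ℓ' : ℤ) ∣ NumberField.discr K) ∧
          ℓ' ≠ 2 ∧ (Ideal.span {(ℓ' : 𝓞 K)}).IsPrime ∧
          FrobEqFrobInfty (cubeSumCurve (3 * (p : ℚ) ^ 2)) K 2 ℓ' ∧
          FrobEqFrobInfty (cubeSumCurve (p : ℚ)) K 2 ℓ') → ℓ ≠ ℓ' →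
        (∃ (ιK : K →+* ℂ) (emb : ringClassField K ιK (9 * p * (ℓ * ℓ')) →+* AlgebraicClosure K)
            (_ : ∀ k : K, emb (algebraMap K (ringClassField K ιK (9 * p * (ℓ * ℓ'))) k) =
              algebraMap K (AlgebraicClosure K) k)
            (N : Subgroup (Field.absoluteGaloisGroup K))
            (_ : ∀ g, g ∈ N ↔ ∀ x : ringClassField K ιK (9 * p * (ℓ * ℓ')),
              (show AlgebraicClosure K ≃ₐ[K] AlgebraicClosure K from g) (emb x) = emb x)
            (v : AlgebraicClosure K)
            (ψ : geomPoints ((cubeSumCurve 9).baseChange K) ≃+ geomPoints ((cubeSumCurve (p : ℚ)).baseChange K))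
            (_ : ∀ {x y : AlgebraicClosure K}
              (h : (((cubeSumCurve 9).baseChange K).baseChange (AlgebraicClosure K)).toAffine.Nonsingular
                x y), ∃ h', ψ (Affine.Point.some x y h) = Affine.Point.some (v ^ 2 * x) (v ^ 3 * y) h')
            (_ : ∀ h ∈ N, (show AlgebraicClosure K ≃ₐ[K] AlgebraicClosure K from h) v = v)
            (A : AddSubgroup (geomPoints ((cubeSumCurve (p : ℚ)).baseChange K)))
            (hdiv : ∀ P : geomPoints ((cubeSumCurve (p : ℚ)).baseChange K), ∃ R : geomPoints ((cubeSumCurve (p : ℚ)).baseChange K), ((2 : ℕ) : ℤ) • R = P)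
            (hA : KolyvaginCocycle.IsAdmissible (Field.absoluteGaloisGroup K) A ((2 : ℕ) : ℤ))
            (Q : geomPoints ((cubeSumCurve 9).baseChange K))
            (_ : Q ∈ FixedPoints.addSubgroup N (geomPoints ((cubeSumCurve 9).baseChange K)))
            (hQ' : ψ Q ∈ KolyvaginCocycle.invPoints (Field.absoluteGaloisGroup K) A ((2 : ℕ) : ℤ)),
            cB (ℓ * ℓ') = kolyvaginClass ((cubeSumCurve (p : ℚ)).baseChange K) ((2 : ℕ) : ℤ) hdiv hA (ψ Q) hQ') ∧
        (∀ v : HeightOneSpectrum (𝓞 K), ((3 : ℕ) : 𝓞 K) ∈ v.asIdeal →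
          cB (ℓ * ℓ') ∈ selmerLocalKer ((cubeSumCurve (p : ℚ)).baseChange K)
            (v.adicCompletion K) (2 : ℕ)) ∧
        (∀ v : HeightOneSpectrum (𝓞 K), (ℓ : 𝓞 K) ∈ v.asIdeal →
          (cB (ℓ * ℓ') ∈ selmerLocalKer ((cubeSumCurve (p : ℚ)).baseChange K)
              (v.adicCompletion K) (2 : ℕ) ↔
            cA ℓ' ∈ ((cubeSumCurve (3 * (p : ℚ) ^ 2)).baseChange K).torsionLocalKer
              (v.adicCompletion K) (2 : ℕ))))) :
    ∃ (cA : ℕ → galH1Torsion ((cubeSumCurve (3 * (p : ℚ) ^ 2)).baseChange K) (2 : ℕ))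
      (cB : ℕ → galH1Torsion ((cubeSumCurve (p : ℚ)).baseChange K) (2 : ℕ)),
    (∀ ℓ, (ℓ.Prime ∧ ¬ ℓ ∣ (cubeSumCurve (3 * (p : ℚ) ^ 2)).conductorNorm ℤ ∧
        ¬ ℓ ∣ (cubeSumCurve (p : ℚ)).conductorNorm ℤ ∧ ¬ ((ℓ : ℤ) ∣ NumberField.discr K) ∧ ℓ ≠ 2 ∧
        (Ideal.span {(ℓ : 𝓞 K)}).IsPrime ∧
        FrobEqFrobInfty (cubeSumCurve (3 * (p : ℚ) ^ 2)) K 2 ℓ ∧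
        FrobEqFrobInfty (cubeSumCurve (p : ℚ)) K 2 ℓ) →
      (∀ v : HeightOneSpectrum (𝓞 K), (ℓ : 𝓞 K) ∉ v.asIdeal →
        cA ℓ ∈ selmerLocalKer ((cubeSumCurve (3 * (p : ℚ) ^ 2)).baseChange K)
          (v.adicCompletion K) (2 : ℕ)) ∧
      (∀ x : InfinitePlace K, cA ℓ ∈ selmerLocalKer
        ((cubeSumCurve (3 * (p : ℚ) ^ 2)).baseChange K) x.Completion (2 : ℕ)) ∧
      (∀ v : HeightOneSpectrum (𝓞 K), (ℓ : 𝓞 K) ∈ v.asIdeal →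
        (cA ℓ ∈ selmerLocalKer ((cubeSumCurve (3 * (p : ℚ) ^ 2)).baseChange K)
            (v.adicCompletion K) (2 : ℕ) ↔
          kummerClassOfPoint (cubeSumCurve (p : ℚ)) K Nat.prime_two Y₁ ∈
            ((cubeSumCurve (p : ℚ)).baseChange K).torsionLocalKer (v.adicCompletion K) (2 : ℕ)))) ∧
    (∀ ℓ ℓ', (ℓ.Prime ∧ ¬ ℓ ∣ (cubeSumCurve (3 * (p : ℚ) ^ 2)).conductorNorm ℤ ∧
        ¬ ℓ ∣ (cubeSumCurve (p : ℚ)).conductorNorm ℤ ∧ ¬ ((ℓ : ℤ) ∣ NumberField.discr K) ∧ ℓ ≠ 2 ∧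
        (Ideal.span {(ℓ : 𝓞 K)}).IsPrime ∧
        FrobEqFrobInfty (cubeSumCurve (3 * (p : ℚ) ^ 2)) K 2 ℓ ∧
        FrobEqFrobInfty (cubeSumCurve (p : ℚ)) K 2 ℓ) →
      (ℓ'.Prime ∧ ¬ ℓ' ∣ (cubeSumCurve (3 * (p : ℚ) ^ 2)).conductorNorm ℤ ∧
        ¬ ℓ' ∣ (cubeSumCurve (p : ℚ)).conductorNorm ℤ ∧ ¬ ((ℓ' : ℤ) ∣ NumberField.discr K) ∧
        ℓ' ≠ 2 ∧ (Ideal.span {(ℓ' : 𝓞 K)}).IsPrime ∧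
        FrobEqFrobInfty (cubeSumCurve (3 * (p : ℚ) ^ 2)) K 2 ℓ' ∧
        FrobEqFrobInfty (cubeSumCurve (p : ℚ)) K 2 ℓ') → ℓ ≠ ℓ' →
      (∀ v : HeightOneSpectrum (𝓞 K), (ℓ : 𝓞 K) ∉ v.asIdeal → (ℓ' : 𝓞 K) ∉ v.asIdeal →
        cB (ℓ * ℓ') ∈ selmerLocalKer ((cubeSumCurve (p : ℚ)).baseChange K)
          (v.adicCompletion K) (2 : ℕ)) ∧
      (∀ x : InfinitePlace K,
        cB (ℓ * ℓ') ∈ selmerLocalKer ((cubeSumCurve (p : ℚ)).baseChange K) x.Completion (2 : ℕ)) ∧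
      (∀ v : HeightOneSpectrum (𝓞 K), (ℓ : 𝓞 K) ∈ v.asIdeal →
        (cB (ℓ * ℓ') ∈ selmerLocalKer ((cubeSumCurve (p : ℚ)).baseChange K)
            (v.adicCompletion K) (2 : ℕ) ↔
          cA ℓ' ∈ ((cubeSumCurve (3 * (p : ℚ) ^ 2)).baseChange K).torsionLocalKer
            (v.adicCompletion K) (2 : ℕ)))) := by
  obtain ⟨cA, cB, hAℓ, hBℓ⟩ := h
  have hK : IsImaginaryQuadratic K := JZero.isImaginaryQuadratic_of_sq_add_self_add_one hω h2
  have hp2 : p ≠ 2 := by rintro rfl; norm_num at h9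
  have hp3 : p ≠ 3 := by rintro rfl; norm_num at h9
  have hp0 : p ≠ 0 := hp.ne_zero
  refine ⟨cA, cB, fun ℓ hℓ ↦ ⟨?_, ?_, (hAℓ ℓ hℓ).2⟩, fun ℓ ℓ' hℓ hℓ' hne ↦ ⟨?_, ?_, (hBℓ ℓ ℓ' hℓ hℓ' hne).2.2⟩⟩
  · -- `c_A(ℓ)` off `ℓ`: finite places
    intro v hℓv
    by_cases hpv : ((p : ℕ) : 𝓞 K) ∈ v.asIdeal
    · exact (mem_localKers_cubeSumCurve_three_mul_sq_of_mem hω h2 hp hp2 hp3 v hpv 1 (cA ℓ)).1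
    by_cases h3v : ((3 : ℕ) : 𝓞 K) ∈ v.asIdeal
    · exact (mem_localKers_cubeSumCurve_three_mul_sq_of_three_mem hω h2 hp hp3 v h3v 1 (cA ℓ)).1
    obtain ⟨⟨ιK, emb, hemb, N, hN, v9, ψ, hψ, hNv, A, hdiv, hA, Q, hQN, hQ', hc⟩, -⟩ := hAℓ ℓ hℓ
    rw [hc]
    have hℓ0 : ℓ ≠ 0 := hℓ.1.ne_zero
    exact kolyvaginClass_cmFrame_cubeSumCurve_three_mul_sq_mem_selmerLocalKer hK ιK
      (by positivity) emb hemb N hN hp hp2 hψ hNv hA hQN hQ' v h3v hpv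
      (natCast_nine_mul_not_mem v h3v hpv hℓv)
  · -- `c_A(ℓ)` at `∞`
    intro x
    exact mem_selmerLocalKer_infinitePlace_of_isImaginaryQuadratic hK _ x (cA ℓ)
  · -- `c_B(ℓℓ′)` off `ℓ, ℓ′`: finite places
    intro v hℓv hℓ'v
    by_cases hpv : ((p : ℕ) : 𝓞 K) ∈ v.asIdeal
    · exact (mem_localKers_cubeSumCurve_prime_of_mem hω h2 hp hp2 hp3 v hpv 1 (cB (ℓ * ℓ'))).1
    obtain ⟨⟨ιK, emb, hemb, N, hN, v9, ψ, hψ, hNv, A, hdiv, hA, Q, hQN, hQ', hc⟩, hB3, -⟩ :=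
      hBℓ ℓ ℓ' hℓ hℓ' hne
    by_cases h3v : ((3 : ℕ) : 𝓞 K) ∈ v.asIdeal
    · exact hB3 v h3v
    rw [hc]
    have hℓ0 : ℓ ≠ 0 := hℓ.1.ne_zero
    have hℓ'0 : ℓ' ≠ 0 := hℓ'.1.ne_zero
    exact kolyvaginClass_cmFrame_cubeSumCurve_prime_mem_selmerLocalKer hK ιK (by positivity) emb hemb
      N hN hp hp2 hψ hNv hA hQN hQ' v h3v hpv
      (natCast_nine_mul_not_mem v h3v hpv (natCast_mul_not_mem v hℓv hℓ'v))
  · -- `c_B(ℓℓ′)` at `∞`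
    intro x
    exact mem_selmerLocalKer_infinitePlace_of_isImaginaryQuadratic hK _ x (cB (ℓ * ℓ'))

end OffLevel

end Summit.BirchSwinnertonDyer.BirchSwinnertonDyer.Theorems.SylvesterTwoCoupledDescentCebotarev

end
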